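import Summits.BirchSwinnertonDyer.BirchSwinnertonDyer.Theses.PAdicOrderV2
import Literature.NumberTheory.EllipticCurves.PAdicBSDInterpolationProofs
import Literature.NumberTheory.EllipticCurves.LeadingTermPPartProofs

/-!
# Crux `PAdicOrderV2.PAdicOrderRankOneR4` (stmt-BirchSwinnertonDyer-0515), line `Sketch` — stub `stub_one_le_order`

The stub `stub_one_le_order` of the tame-shadow skeleton (`Cruxes/PAdicOrderRankOneR4/Lines/Sketch`)
is the EASY half of "`ord_T L_p(E,T) = 1` in analytic rank one at a good ordinary prime", namely

  `1 ≤ ord_T L_p(E, T)`, i.e. `L_p(E, 0) = 0`.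

Proof (Mazur–Tate–Teitelbaum 1986, §I.14, (14.3) at the trivial character), entirely from proved
tree theorems:

* `constantCoeff_padicLFunction_unitRoot` (`PAdicBSDInterpolationProofs`):
  `L_p(E, 0) = (1 - α⁻¹)² · [0]⁺_f` with `α = unitRoot W p`;
* `IsNewformOf.entireLFunction_one_eq` (`LeadingTermPPartProofs`): `L(E, 1) = [0]⁺_f · Ω⁺_f` in `ℂ`;
* `IsNewform0.plusPeriod_pos_holds`: `Ω⁺_f > 0`;
* `W.analyticRank = analyticOrderNatAt W.entireLFunction 1`, so `analyticRank = 1 ≠ 0` forces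
  `L(E, 1) = 0` (Mathlib `apply_eq_zero_of_analyticOrderNatAt_ne_zero`).

Hence `[0]⁺_f = 0`, so the constant coefficient of `L_p(E, T)` vanishes, so `1 ≤ order`
(Mathlib `PowerSeries.one_le_order_iff_constCoeff_eq_zero`).
-/

-- D-0017: single-problem summit, so `Summit.BirchSwinnertonDyer.BirchSwinnertonDyer.…` repeats a
-- namespace BY DESIGN (the `Summits` lib sets this option in `lakefile.toml`; repeated for standalone checks).
set_option linter.dupNamespace false

noncomputable section

namespace Summit.BirchSwinnertonDyer.BirchSwinnertonDyer.Theorems.TameShadow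

open CongruenceSubgroup PowerSeries
open Literature.NumberTheory.EllipticCurves Literature.NumberTheory.EllipticCurves.ModularForms

/-- **`L(E, 1) = 0` in positive analytic rank.** If `W.analyticRank ≠ 0` then
`W.entireLFunction 1 = 0`: `analyticRank W = analyticOrderNatAt W.entireLFunction 1`, and a
function with nonzero (natural) analytic order at a point vanishes there (if it were not analytic
at `1`, or nonzero at `1`, the order would be `0`). [folklore] -/
theorem entireLFunction_one_eq_zero_of_analyticRank_ne_zero (W : WeierstrassCurve ℚ)
    (hr : W.analyticRank ≠ 0) : W.entireLFunction 1 = 0 :=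
  apply_eq_zero_of_analyticOrderNatAt_ne_zero hr

/-- **`[0]⁺_f = 0` for the newform of a curve of positive analytic rank.** For `f` the newform of an
elliptic `W/ℚ` with `W.analyticRank ≠ 0`, the rational plus symbol `[0]⁺_f = L(E,1)/Ω⁺_f` vanishes:
`L(E, 1) = [0]⁺_f · Ω⁺_f` (`IsNewformOf.entireLFunction_one_eq`), `Ω⁺_f > 0`
(`IsNewform0.plusPeriod_pos_holds`) and `L(E, 1) = 0`. Mazur–Tate–Teitelbaum 1986, §I.8:
`[0]⁺ = L(f,1)/Ω⁺`. [cite: MazurTateTeitelbaum1986Invent, §I.8 (8.6)] -/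
theorem ratPlusSymbol_zero_eq_zero_of_analyticRank_ne_zero (W : WeierstrassCurve ℚ) [W.IsElliptic]
    (hr : W.analyticRank ≠ 0) {N : ℕ} [NeZero N] (f : CuspForm (Gamma0 N) 2) (hf : IsNewformOf W f) :
    ratPlusSymbol f 0 = 0 := by
  have hpos : 0 < plusPeriod f := IsNewform0.plusPeriod_pos_holds hf.1 hf.coeffField_eq_bot
  have hL : W.entireLFunction 1 = 0 := entireLFunction_one_eq_zero_of_analyticRank_ne_zero W hr
  have hval : W.entireLFunction 1 = ((((ratPlusSymbol f 0 : ℚ) : ℝ) * plusPeriod f : ℝ) : ℂ) :=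
    hf.entireLFunction_one_eq
  rw [hL] at hval
  have hreal : ((ratPlusSymbol f 0 : ℚ) : ℝ) * plusPeriod f = 0 := by
    exact_mod_cast hval.symm
  rcases mul_eq_zero.mp hreal with h | h
  · exact_mod_cast h
  · exact absurd h hpos.ne'

/-- **Stub `stub_one_le_order` (S1 of line `Sketch`): `1 ≤ ord_T L_p(E, T)` in analytic rank one.**
For `W/ℚ` elliptic and globally minimal, `p` a good ordinary prime (`IsOrdinaryAt W p`),
`W.analyticRank = 1` and `f ∈ S₂(Γ₀(N))` the newform of `W`, the Mazur–Swinnerton-Dyer `p`-adic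
`L`-function `L_p(E, T) = padicLFunction f (unitRoot W p)` has `T`-order at least one: by the
interpolation property at the trivial character, `L_p(E, 0) = (1 - α⁻¹)² [0]⁺_f`
(`constantCoeff_padicLFunction_unitRoot`), and `[0]⁺_f = L(E,1)/Ω⁺_f = 0` because `L(E, 1) = 0` in
analytic rank one (`ratPlusSymbol_zero_eq_zero_of_analyticRank_ne_zero`). Mazur–Tate–Teitelbaum
1986, §I.14, (14.3). [cite: MazurTateTeitelbaum1986Invent, §I.14 (14.3)] -/
theorem stub_one_le_order :
    ∀ (W : WeierstrassCurve ℚ) [W.IsElliptic] [W.IsGloballyMinimal] (p : ℕ) [Fact p.Prime],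
      IsOrdinaryAt W p → W.analyticRank = 1 →
      ∀ {N : ℕ} [NeZero N] (f : CuspForm (Gamma0 N) 2), IsNewformOf W f →
        (1 : ℕ∞) ≤ (padicLFunction f (unitRoot W p : ℚ_[p])).order := by
  intro W _ _ p _ hord hr N _ f hf
  rw [PowerSeries.one_le_order_iff_constCoeff_eq_zero, constantCoeff_padicLFunction_unitRoot hord hf,
    ratPlusSymbol_zero_eq_zero_of_analyticRank_ne_zero W (by omega) f hf]
  simp

end Summit.BirchSwinnertonDyer.BirchSwinnertonDyer.Theorems.TameShadow

end
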